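import Mathlib

/-!
# Crux `GappedShellCensus.FiveFoldRationingR` (stmt-AtomisticToContinuum-18071), line `Sketch` —
# helpers for the stub `stub_ffrRodTransfer` (the bond graph on the subtype `↥Y`)

For a set `Y ⊆ ℝ³` and a radius `r`, a BOND GRAPH on the subtype `↥Y` is a simple graph `G` with
`G.Adj u v ↔ (u : ℝ³) ≠ v ∧ dist u v ≤ r` (`ffrRT_graph_exists`).  This file transports the bookkeeping
of the rod statement between `Y` (sets of points of `ℝ³` cut out by `dist ≤ r`) and `G` (adjacency):
* common bonded partners and five-bond partners correspond under `Subtype.val`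
  (`ffrRT_common_eq`, `ffrRT_common_ncard`, `ffrRT_fiveBond_iff`, `ffrRT_fiveSite`);
* labelled twelve-shells of `Y` are labelled links of `G` (`ffrRT_links`);
* greedy bond routing in `Y` gives walks of `G` of length `≤ 4·dist/a + 3`, so `G` is connected
  (`ffrRT_walk`, `ffrRT_connected`);
* balls of a locally finite graph are finite (`ffrRT_ball_finite`), and cubic growth of the number of
  sites in Euclidean balls gives cubic growth of the balls of `G` (`ffrRT_growth`).
-/

noncomputable section

namespace Summit.AtomisticToContinuum.Crystallization.Theorems

/-- A bond graph on `↥Y` exists: adjacency = distinct and within distance `r`. -/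
theorem ffrRT_graph_exists (Y : Set (EuclideanSpace ℝ (Fin 3))) (r : ℝ) :
    ∃ G : SimpleGraph ↥Y, ∀ u v : ↥Y,
      G.Adj u v ↔ (u : EuclideanSpace ℝ (Fin 3)) ≠ v ∧ dist (u : EuclideanSpace ℝ (Fin 3)) v ≤ r := by
  refine ⟨SimpleGraph.fromRel fun u v => dist (u : EuclideanSpace ℝ (Fin 3)) v ≤ r, fun u v => ?_⟩
  rw [SimpleGraph.fromRel_adj]
  constructor
  · rintro ⟨hne, h⟩
    refine ⟨fun heq => hne (Subtype.ext heq), ?_⟩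
    rcases h with h | h
    · exact h
    · rwa [dist_comm] at h
  · rintro ⟨hne, h⟩
    exact ⟨fun heq => hne (congrArg Subtype.val heq), Or.inl h⟩

/-- The common bonded partners of `y, v ∈ Y` are the images under `Subtype.val` of the common
neighbours of `y` and `v` in the bond graph. -/
theorem ffrRT_common_eq {Y : Set (EuclideanSpace ℝ (Fin 3))} {r : ℝ} (G : SimpleGraph ↥Y)
    (hG : ∀ u v : ↥Y, G.Adj u v ↔
      (u : EuclideanSpace ℝ (Fin 3)) ≠ v ∧ dist (u : EuclideanSpace ℝ (Fin 3)) v ≤ r)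
    (y v : ↥Y) :
    {w ∈ Y | w ≠ (y : EuclideanSpace ℝ (Fin 3)) ∧ w ≠ (v : EuclideanSpace ℝ (Fin 3)) ∧
        dist (y : EuclideanSpace ℝ (Fin 3)) w ≤ r ∧ dist (v : EuclideanSpace ℝ (Fin 3)) w ≤ r} =
      Subtype.val '' {w : ↥Y | G.Adj y w ∧ G.Adj v w} := by
  ext w
  constructor
  · rintro ⟨hwY, hwy, hwv, hyw, hvw⟩
    exact ⟨⟨w, hwY⟩, ⟨(hG _ _).2 ⟨fun h => hwy h.symm, hyw⟩, (hG _ _).2 ⟨fun h => hwv h.symm, hvw⟩⟩,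
      rfl⟩
  · rintro ⟨w', ⟨hyw', hvw'⟩, rfl⟩
    obtain ⟨h1, h2⟩ := (hG _ _).1 hyw'
    obtain ⟨h3, h4⟩ := (hG _ _).1 hvw'
    exact ⟨w'.2, fun h => h1 h.symm, fun h => h3 h.symm, h2, h4⟩

/-- Hence `y, v ∈ Y` have as many common bonded partners in `Y` as common neighbours in the bond
graph. -/
theorem ffrRT_common_ncard {Y : Set (EuclideanSpace ℝ (Fin 3))} {r : ℝ} (G : SimpleGraph ↥Y)
    (hG : ∀ u v : ↥Y, G.Adj u v ↔
      (u : EuclideanSpace ℝ (Fin 3)) ≠ v ∧ dist (u : EuclideanSpace ℝ (Fin 3)) v ≤ r)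
    (y v : ↥Y) :
    {w ∈ Y | w ≠ (y : EuclideanSpace ℝ (Fin 3)) ∧ w ≠ (v : EuclideanSpace ℝ (Fin 3)) ∧
        dist (y : EuclideanSpace ℝ (Fin 3)) w ≤ r ∧ dist (v : EuclideanSpace ℝ (Fin 3)) w ≤ r}.ncard =
      ({w : ↥Y | G.Adj y w ∧ G.Adj v w} : Set ↥Y).ncard := by
  rw [ffrRT_common_eq G hG y v, Set.ncard_image_of_injective _ Subtype.val_injective]

/-- Five-bond partners correspond: for `y v : ↥Y`, the point `↑v` is a five-bond partner of `↑y` in `Y`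
iff `v` is a five-bond partner of `y` in the bond graph. -/
theorem ffrRT_fiveBond_iff {Y : Set (EuclideanSpace ℝ (Fin 3))} {r : ℝ} (G : SimpleGraph ↥Y)
    (hG : ∀ u v : ↥Y, G.Adj u v ↔
      (u : EuclideanSpace ℝ (Fin 3)) ≠ v ∧ dist (u : EuclideanSpace ℝ (Fin 3)) v ≤ r)
    (y v : ↥Y) :
    (v : EuclideanSpace ℝ (Fin 3)) ∈
        {v ∈ Y | v ≠ (y : EuclideanSpace ℝ (Fin 3)) ∧ dist (y : EuclideanSpace ℝ (Fin 3)) v ≤ r ∧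
          5 ≤ {w ∈ Y | w ≠ (y : EuclideanSpace ℝ (Fin 3)) ∧ w ≠ v ∧
            dist (y : EuclideanSpace ℝ (Fin 3)) w ≤ r ∧ dist v w ≤ r}.ncard} ↔
      v ∈ {v : ↥Y | G.Adj y v ∧ 5 ≤ ({w | G.Adj y w ∧ G.Adj v w} : Set ↥Y).ncard} := by
  have h2 := ffrRT_common_ncard G hG y v
  constructor
  · rintro ⟨-, hvy, hyv, h5⟩
    exact ⟨(hG y v).2 ⟨fun h => hvy h.symm, hyv⟩, h5.trans_eq h2⟩
  · rintro ⟨hadj, h5⟩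
    obtain ⟨hne, hd⟩ := (hG y v).1 hadj
    exact ⟨v.2, fun h => hne h.symm, hd, h5.trans_eq h2.symm⟩

/-- A five-site of `Y` (a site with a five-bond partner) is a five-site of the bond graph. -/
theorem ffrRT_fiveSite {Y : Set (EuclideanSpace ℝ (Fin 3))} {r : ℝ} (G : SimpleGraph ↥Y)
    (hG : ∀ u v : ↥Y, G.Adj u v ↔
      (u : EuclideanSpace ℝ (Fin 3)) ≠ v ∧ dist (u : EuclideanSpace ℝ (Fin 3)) v ≤ r)
    (y : EuclideanSpace ℝ (Fin 3)) (hy : y ∈ Y)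
    (h : ∃ v ∈ Y, v ≠ y ∧ dist y v ≤ r ∧
      5 ≤ {w ∈ Y | w ≠ y ∧ w ≠ v ∧ dist y w ≤ r ∧ dist v w ≤ r}.ncard) :
    (⟨y, hy⟩ : ↥Y) ∈
      {y : ↥Y | ∃ v, G.Adj y v ∧ 5 ≤ ({w | G.Adj y w ∧ G.Adj v w} : Set ↥Y).ncard} := by
  obtain ⟨v, hv, hvy, hyv, h5⟩ := h
  exact ⟨⟨v, hv⟩, (hG _ _).2 ⟨fun h => hvy h.symm, hyv⟩,
    h5.trans_eq (ffrRT_common_ncard G hG ⟨y, hy⟩ ⟨v, hv⟩)⟩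

/-- Labelled twelve-shells of `Y` (injective `e : Fin 12 → ℝ³` onto the shell, with the bond table one of
three given edge lists) are labelled links of the bond graph, with the same three edge lists. -/
theorem ffrRT_links {Y : Set (EuclideanSpace ℝ (Fin 3))} {r : ℝ} (G : SimpleGraph ↥Y)
    (hG : ∀ u v : ↥Y, G.Adj u v ↔
      (u : EuclideanSpace ℝ (Fin 3)) ≠ v ∧ dist (u : EuclideanSpace ℝ (Fin 3)) v ≤ r)
    (L₁ L₂ L₃ : List (ℕ × ℕ))
    (hL : ∀ y ∈ Y, ∃ e : Fin 12 → EuclideanSpace ℝ (Fin 3), Function.Injective e ∧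
      Set.range e = {w ∈ Y | w ≠ y ∧ dist y w ≤ r} ∧
      ((∀ i j : Fin 12, i < j → (dist (e i) (e j) ≤ r ↔ (i.val, j.val) ∈ L₁)) ∨
        (∀ i j : Fin 12, i < j → (dist (e i) (e j) ≤ r ↔ (i.val, j.val) ∈ L₂)) ∨
        (∀ i j : Fin 12, i < j → (dist (e i) (e j) ≤ r ↔ (i.val, j.val) ∈ L₃))))
    (v : ↥Y) :
    ∃ e : Fin 12 → ↥Y, Function.Injective e ∧ Set.range e = {w | G.Adj v w} ∧
      ((∀ i j : Fin 12, i < j → (G.Adj (e i) (e j) ↔ (i.val, j.val) ∈ L₁)) ∨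
        (∀ i j : Fin 12, i < j → (G.Adj (e i) (e j) ↔ (i.val, j.val) ∈ L₂)) ∨
        (∀ i j : Fin 12, i < j → (G.Adj (e i) (e j) ↔ (i.val, j.val) ∈ L₃))) := by
  obtain ⟨e, he, hrange, hadj⟩ := hL v v.2
  have heS : ∀ i, e i ∈ Y ∧ e i ≠ (v : EuclideanSpace ℝ (Fin 3)) ∧
      dist (v : EuclideanSpace ℝ (Fin 3)) (e i) ≤ r := fun i => by
    have h : e i ∈ Set.range e := ⟨i, rfl⟩
    rw [hrange] at h
    exact h
  -- transfer of one bond table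
  have hT : ∀ L : List (ℕ × ℕ),
      (∀ i j : Fin 12, i < j → (dist (e i) (e j) ≤ r ↔ (i.val, j.val) ∈ L)) →
      ∀ i j : Fin 12, i < j →
        (G.Adj ⟨e i, (heS i).1⟩ ⟨e j, (heS j).1⟩ ↔ (i.val, j.val) ∈ L) := by
    intro L h i j hij
    rw [hG, ← h i j hij]
    exact ⟨fun h' => h'.2, fun h' => ⟨fun heq => absurd (he heq) (ne_of_lt hij), h'⟩⟩
  refine ⟨fun i => ⟨e i, (heS i).1⟩, fun i j hij => he (congrArg Subtype.val hij), ?_, ?_⟩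
  · ext w
    simp only [Set.mem_range, Set.mem_setOf_eq]
    constructor
    · rintro ⟨i, rfl⟩
      exact (hG _ _).2 ⟨fun h => (heS i).2.1 h.symm, (heS i).2.2⟩
    · intro hw
      obtain ⟨hne, hd⟩ := (hG _ _).1 hw
      have hw' : (w : EuclideanSpace ℝ (Fin 3)) ∈ Set.range e := by
        rw [hrange]
        exact ⟨w.2, fun h => hne h.symm, hd⟩
      obtain ⟨i, hi⟩ := hw'
      exact ⟨i, Subtype.ext hi⟩
  · rcases hadj with h | h | h
    · exact Or.inl (hT _ h)
    · exact Or.inr (Or.inl (hT _ h))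
    · exact Or.inr (Or.inr (hT _ h))

/-- Greedy bond routing in `Y` (a bond path from `u` to `v` with `≤ 4·dist u v / a + 3` steps, stutters
allowed) gives a walk of the bond graph from `u` to `v` of length `≤ 4·dist u v / a + 3`. -/
theorem ffrRT_walk {Y : Set (EuclideanSpace ℝ (Fin 3))} {a : ℝ} (G : SimpleGraph ↥Y)
    (hG : ∀ u v : ↥Y, G.Adj u v ↔
      (u : EuclideanSpace ℝ (Fin 3)) ≠ v ∧ dist (u : EuclideanSpace ℝ (Fin 3)) v ≤ a * (1 + 1 / 50))
    (hGreedy : ∀ u ∈ Y, ∀ v ∈ Y, ∃ (n : ℕ) (g : ℕ → EuclideanSpace ℝ (Fin 3)), g 0 = u ∧ g n = v ∧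
      (∀ k, g k ∈ Y) ∧ (∀ k, k < n → dist (g k) (g (k + 1)) ≤ a * (1 + 1 / 50)) ∧
      (n : ℝ) ≤ 4 * dist u v / a + 3)
    (u v : ↥Y) :
    ∃ p : G.Walk u v, (p.length : ℝ) ≤ 4 * dist (u : EuclideanSpace ℝ (Fin 3)) v / a + 3 := by
  obtain ⟨n, g, hg0, hgn, hgY, hstep, hn⟩ := hGreedy u u.2 v v.2
  -- walks to the intermediate sites, skipping stutters
  have key : ∀ k, k ≤ n → ∃ p : G.Walk u ⟨g k, hgY k⟩, p.length ≤ k := by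
    intro k
    induction k with
    | zero =>
      intro _
      exact ⟨SimpleGraph.Walk.nil.copy rfl (Subtype.ext hg0.symm), by
        rw [SimpleGraph.Walk.length_copy, SimpleGraph.Walk.length_nil]⟩
    | succ k ih =>
      intro hk
      obtain ⟨p, hp⟩ := ih (Nat.le_of_succ_le hk)
      by_cases heq : g k = g (k + 1)
      · exact ⟨p.copy rfl (Subtype.ext heq), by rw [SimpleGraph.Walk.length_copy]; omega⟩
      · have hadj : G.Adj ⟨g k, hgY k⟩ ⟨g (k + 1), hgY (k + 1)⟩ :=
          (hG _ _).2 ⟨heq, hstep k (Nat.lt_of_succ_le hk)⟩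
        exact ⟨p.concat hadj, by rw [SimpleGraph.Walk.length_concat]; omega⟩
  obtain ⟨p, hp⟩ := key n le_rfl
  refine ⟨p.copy rfl (Subtype.ext hgn), ?_⟩
  rw [SimpleGraph.Walk.length_copy]
  exact le_trans (by exact_mod_cast hp) hn

/-- The bond graph of a non-empty `Y` with greedy bond routing is connected. -/
theorem ffrRT_connected {Y : Set (EuclideanSpace ℝ (Fin 3))} {a : ℝ} (G : SimpleGraph ↥Y)
    (hG : ∀ u v : ↥Y, G.Adj u v ↔
      (u : EuclideanSpace ℝ (Fin 3)) ≠ v ∧ dist (u : EuclideanSpace ℝ (Fin 3)) v ≤ a * (1 + 1 / 50))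
    (hne : Y.Nonempty)
    (hGreedy : ∀ u ∈ Y, ∀ v ∈ Y, ∃ (n : ℕ) (g : ℕ → EuclideanSpace ℝ (Fin 3)), g 0 = u ∧ g n = v ∧
      (∀ k, g k ∈ Y) ∧ (∀ k, k < n → dist (g k) (g (k + 1)) ≤ a * (1 + 1 / 50)) ∧
      (n : ℝ) ≤ 4 * dist u v / a + 3) :
    G.Connected := by
  rw [SimpleGraph.connected_iff]
  obtain ⟨y, hy⟩ := hne
  exact ⟨fun u v => (ffrRT_walk G hG hGreedy u v).elim fun p _ => ⟨p⟩, ⟨⟨y, hy⟩⟩⟩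

/-- In a locally finite simple graph the set of vertices reached from `v` by walks of length `≤ R` is
finite. -/
theorem ffrRT_ball_finite {V : Type*} (G : SimpleGraph V) (hloc : ∀ v : V, {w | G.Adj v w}.Finite) :
    ∀ (R : ℕ) (v : V), {w : V | ∃ p : G.Walk v w, p.length ≤ R}.Finite := by
  intro R
  induction R with
  | zero =>
    intro v
    refine (Set.finite_singleton v).subset ?_
    rintro w ⟨p, hp⟩
    rw [Set.mem_singleton_iff]
    exact (SimpleGraph.Walk.eq_of_length_eq_zero (Nat.le_zero.mp hp)).symm
  | succ R ih =>
    intro v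
    refine ((Set.finite_singleton v).union ((hloc v).biUnion fun u _ => ih u)).subset ?_
    rintro w ⟨p, hp⟩
    cases p with
    | nil => exact Or.inl rfl
    | cons h q =>
      refine Or.inr (Set.mem_biUnion h ⟨q, ?_⟩)
      rw [SimpleGraph.Walk.length_cons] at hp
      omega

/-- **Cubic growth of graph balls.** If the bond graph `G` on `↥Y` is connected and locally finite, any
two sites are joined by a walk of length `≤ 4·dist/a + 3`, and Euclidean balls `B(p, 13 a n)` contain
`≥ n³` sites, then the balls of `G` grow cubically: `#{w | G.dist v w ≤ R} ≥ (R/110)³` for `R ≥ 55`. -/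
theorem ffrRT_growth {Y : Set (EuclideanSpace ℝ (Fin 3))} {a : ℝ} (ha : 0 < a) (G : SimpleGraph ↥Y)
    (hconn : G.Connected) (hloc : ∀ v : ↥Y, {w | G.Adj v w}.Finite)
    (hwalk : ∀ u v : ↥Y, ∃ p : G.Walk u v,
      (p.length : ℝ) ≤ 4 * dist (u : EuclideanSpace ℝ (Fin 3)) v / a + 3)
    (hvol : ∀ (p : EuclideanSpace ℝ (Fin 3)) (n : ℕ),
      (n : ℝ) ^ 3 ≤ ((Y ∩ Metric.closedBall p (13 * a * n)).ncard : ℝ)) :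
    ∃ (r₀ : ℕ) (c : ℝ), 0 < c ∧ ∀ (v : ↥Y) (r : ℕ), r₀ ≤ r →
      c * (r : ℝ) ^ 3 ≤ (({w | G.dist v w ≤ r} : Set ↥Y).ncard : ℝ) := by
  refine ⟨55, (1 / 110) ^ 3, by positivity, ?_⟩
  intro v R hR
  -- `n = ⌊R / 55⌋ ≥ 1`, so `52 n + 3 ≤ R ≤ 110 n`
  obtain ⟨n, hn⟩ : ∃ n : ℕ, n = R / 55 := ⟨_, rfl⟩
  have h1 : n * 55 ≤ R := by omega
  have h2 : R < n * 55 + 55 := by omega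
  have h3 : 1 ≤ n := by omega
  have h1' : (n : ℝ) * 55 ≤ R := by exact_mod_cast h1
  have h2' : (R : ℝ) < n * 55 + 55 := by exact_mod_cast h2
  have h3' : (1 : ℝ) ≤ n := by exact_mod_cast h3
  have hnR : (R : ℝ) ≤ 110 * n := by linarith
  have h52 : (52 : ℝ) * n + 3 ≤ R := by linarith
  -- the sites in the Euclidean ball `B(v, 13 a n)` lie in the graph ball of radius `R`
  have himage : Y ∩ Metric.closedBall (v : EuclideanSpace ℝ (Fin 3)) (13 * a * n) =
      Subtype.val '' {w : ↥Y | dist (v : EuclideanSpace ℝ (Fin 3)) w ≤ 13 * a * n} := by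
    ext x
    simp only [Set.mem_inter_iff, Metric.mem_closedBall, Set.mem_image, Set.mem_setOf_eq]
    constructor
    · rintro ⟨hx, hd⟩
      exact ⟨⟨x, hx⟩, by rwa [dist_comm], rfl⟩
    · rintro ⟨w, hw, rfl⟩
      exact ⟨w.2, by rwa [dist_comm]⟩
  have hsub : {w : ↥Y | dist (v : EuclideanSpace ℝ (Fin 3)) w ≤ 13 * a * n} ⊆
      {w | G.dist v w ≤ R} := by
    intro w hw
    simp only [Set.mem_setOf_eq] at hw ⊢
    obtain ⟨p, hp⟩ := hwalk v w
    have hd : (G.dist v w : ℝ) ≤ p.length := by exact_mod_cast SimpleGraph.dist_le p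
    have hq : 4 * dist (v : EuclideanSpace ℝ (Fin 3)) w / a ≤ 52 * n := by
      rw [div_le_iff₀ ha]
      nlinarith [hw, ha.le]
    have : (G.dist v w : ℝ) ≤ R := by linarith
    exact_mod_cast this
  have hfin : ({w | G.dist v w ≤ R} : Set ↥Y).Finite := by
    refine (ffrRT_ball_finite G hloc R v).subset ?_
    intro w hw
    obtain ⟨p, hp⟩ := hconn.exists_walk_length_eq_dist v w
    exact ⟨p, by rw [hp]; exact hw⟩
  calc (1 / 110) ^ 3 * (R : ℝ) ^ 3 = (R / 110) ^ 3 := by ring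
    _ ≤ (n : ℝ) ^ 3 := by
        apply pow_le_pow_left₀ (by positivity)
        linarith
    _ ≤ ((Y ∩ Metric.closedBall (v : EuclideanSpace ℝ (Fin 3)) (13 * a * n)).ncard : ℝ) := hvol _ n
    _ = (({w : ↥Y | dist (v : EuclideanSpace ℝ (Fin 3)) w ≤ 13 * a * n} : Set ↥Y).ncard : ℝ) := by
        rw [himage, Set.ncard_image_of_injective _ Subtype.val_injective]
    _ ≤ (({w | G.dist v w ≤ R} : Set ↥Y).ncard : ℝ) := by
        exact_mod_cast Set.ncard_le_ncard hsub hfin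

end Summit.AtomisticToContinuum.Crystallization.Theorems

end
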